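import Summits.ResolutionOfSingularities.ResolutionOfSingularities.Theses.HilbertSamuelElimination
import Summits.ResolutionOfSingularities.ResolutionOfSingularities.Theorems.HilbertSamuelEliminationSigmaMaxModificationsReduction
import Summits.ResolutionOfSingularities.ResolutionOfSingularities.Theorems.HilbertSamuelEliminationSigmaMaxModificationsLevelRaise
import Mathlib.AlgebraicGeometry.Morphisms.Proper
import Mathlib.AlgebraicGeometry.Noetherian
import HarnessLib

/-!
# `SigmaMaxModifications` (crux stmt-ResolutionOfSingularities-18506, route HilbertSamuelElimination):
# REDUCTION TO THE BINDING LEVEL `N = dim X` — the crux ⇔ its two open cores at one level each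

The crux `Summit.ResolutionOfSingularities.ResolutionOfSingularities.Theses.HilbertSamuelElimination.SigmaMaxModifications`
(CJS, LNM 2270, Def. 6.15 in modification form) quantifies over EVERY level `N ≥ dim X` of the
Hilbert–Samuel function `H^N`, and the level matters (`X_max(N+1) ⊊ X_max(N)` happens, refuter
kit `Negative/Levels`). Lead c1's reduction `sigmaMaxModifications_iff_open_cores` (p160700)
therefore left two open cores quantified over all levels. With the landed LEVEL RAISING
`stub_levelRaise` (p163333: the crux body `B(Y, N)` for all `Y/k` of dimension `≤ N` gives
`B(X, N+1)` for all `X/k` of dimension `≤ N` — glue the level-`N` witness of the open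
`{H^N ≤ μ : μ^{(1)} ∈ Σ^max(N+1)}` with the identity) the whole crux is an induction on `N` whose
only inputs are the bodies AT THE BINDING LEVEL `N = dim X` (`body_allLevels_of_baseLevel`, pure
logic over `stub_levelRaise`). Consequences recorded here:

* `sigmaMaxModifications_iff_base_cores` — ASSUMING the two printed theorems vendored as named
  facts (`CossartJannsenSaito2020_sigmaMaxElimination`: CJS Thm. 6.28 + 3.10 (1) + Def. 6.14;
  `CossartPiltant2019General`: CP 2019 Thm. 1.1), the crux is EQUIVALENT to the conjunction of
  (corridor₃) the body `B(X, 3)` for reduced separated finite-type threefolds `X/k` (`dim X = 3`)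
  whose Hilbert–Samuel locus `X_max(3)` meets `closure (Sing X ∖ X_max(3))`, and (high dimension)
  the body `B(X, dim X)` for `dim X ≥ 4` — CJS Def. 6.15 / Cor. 6.18's hypothesis in the authors'
  own normalisation `N = dim X`, and nothing more.
* `SigmaMaxModifications_of_subs_base` — the FACT-FREE glue for a route split at the base level:
  `LowDim → Corridor3@3 → DimGe4@(N = dim X) → SigmaMaxModifications`, with the three hypotheses in
  the route file's inline vocabulary (`LowDim` verbatim as in the strategist's package
  `Cruxes/SigmaMaxModifications/DECOMPOSITION.md`; the two cores restricted to the base level).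

## Sources

* V. Cossart, U. Jannsen, S. Saito, LNM 2270 (2020): Def. 2.28, Rem. 2.29 (b), Def. 6.14/6.15,
  Cor. 6.18, Thm. 6.28, Rem. 6.29. [CossartJannsenSaito2020]
* V. Cossart, O. Piltant, J. Algebra 529 (2019), Thm. 1.1, §1. [CossartPiltant2019]
-/

set_option linter.dupNamespace false -- mandated namespace of this single-conjunct summit

noncomputable section

open CategoryTheory AlgebraicGeometry TopologicalSpace Topology
open Literature.AlgebraicGeometry.Resolution Literature.RingTheory.HilbertSamuel
open Summit.ResolutionOfSingularities.ResolutionOfSingularities.Theses.HilbertSamuelElimination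

namespace Summit.ResolutionOfSingularities.ResolutionOfSingularities.Theorems.SigmaMaxModifications.Sketch

/-! ## The level induction (pure logic over `stub_levelRaise`) -/

/-- **All levels from the binding level.** Over a fixed field `k`: if the crux body `B(X, N)`
holds whenever `N = dim X` (hypothesis `hbase`, stated as `N ≤ dim X ≤ N`), then it holds for
every `N ≥ dim X`. Induction on `N`: at level `N + 1` either `dim X ≤ N` and `stub_levelRaise`
applies to the induction hypothesis, or `dim X = N + 1` is a base level; at level `0` a
non-regular (hence non-empty) `X` of dimension `≤ 0` has dimension `0`.
[cite: CossartJannsenSaito2020, Def. 6.15, Rem. 2.29 (b)] -/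
theorem body_allLevels_of_baseLevel (k : Type) [Field k]
    (hbase : ∀ (N : ℕ) (X : Scheme.{0}) (f : X ⟶ Spec (.of k)), IsSeparated f →
      LocallyOfFiniteType f → QuasiCompact f → IsReduced X → ¬ Scheme.IsRegular X →
      (N : WithBot ℕ∞) ≤ topologicalKrullDim X → topologicalKrullDim X ≤ (N : WithBot ℕ∞) →
        ∃ (X' : Scheme.{0}) (π : X' ⟶ X), IsProper π ∧ IsReduced X' ∧
          topologicalKrullDim X' ≤ ((N : ℕ) : WithBot ℕ∞) ∧
          (∀ U : X.Opens, (U : Set X) ⊆ (Scheme.hsMaxLocus X N)ᶜ → IsIso (π ∣_ U)) ∧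
          Dense ((fun x' => π.base x') ⁻¹' (Scheme.hsMaxLocus X N)ᶜ) ∧
          (∀ x' : X', Scheme.hsFun X' N x' ≤ Scheme.hsFun X N (π.base x')) ∧
          ∀ ν : ℕ → ℕ, Maximal (· ∈ Scheme.hsValues X N) ν → ν ∉ Scheme.hsValues X' N) :
    ∀ (N : ℕ) (X : Scheme.{0}) (f : X ⟶ Spec (.of k)), IsSeparated f →
      LocallyOfFiniteType f → QuasiCompact f → IsReduced X → ¬ Scheme.IsRegular X →
      topologicalKrullDim X ≤ (N : WithBot ℕ∞) →
        ∃ (X' : Scheme.{0}) (π : X' ⟶ X), IsProper π ∧ IsReduced X' ∧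
          topologicalKrullDim X' ≤ ((N : ℕ) : WithBot ℕ∞) ∧
          (∀ U : X.Opens, (U : Set X) ⊆ (Scheme.hsMaxLocus X N)ᶜ → IsIso (π ∣_ U)) ∧
          Dense ((fun x' => π.base x') ⁻¹' (Scheme.hsMaxLocus X N)ᶜ) ∧
          (∀ x' : X', Scheme.hsFun X' N x' ≤ Scheme.hsFun X N (π.base x')) ∧
          ∀ ν : ℕ → ℕ, Maximal (· ∈ Scheme.hsValues X N) ν → ν ∉ Scheme.hsValues X' N := by
  intro N
  induction N with
  | zero =>
    intro X f hsep hft hqc hred hreg hdim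
    refine hbase 0 X f hsep hft hqc hred hreg ?_ hdim
    obtain ⟨x, -⟩ := not_forall.mp hreg
    haveI : Nonempty (IrreducibleCloseds X) :=
      ⟨⟨closure {x}, isIrreducible_singleton.closure, isClosed_closure⟩⟩
    exact_mod_cast (Order.krullDim_nonneg : (0 : WithBot ℕ∞) ≤ topologicalKrullDim X)
  | succ N ih =>
    intro X f hsep hft hqc hred hreg hdim
    rcases dim_le_or_succ_le (topologicalKrullDim X) N with h | h
    · exact stub_levelRaise k N ih X f hsep hft hqc hred hreg h
    · exact hbase (N + 1) X f hsep hft hqc hred hreg h hdim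

/-! ## The base level from the two printed theorems and the two open cores -/

/-- **The binding level `N = dim X`**, graded by `N`: `N ≤ 1` — curves (`stub_curve` ∘
`stub_curveResolution`, unconditional); `N = 2` — the glued CJS fact
(`sigmaMaxModifications_dim_le_two`); `N = 3` — isolated `X_max(3)` by Cossart–Piltant
(`sigmaMaxModifications_dim_le_three_of_isolated`, `X_max(3)` closed by the sharp
semicontinuity) or the corridor hypothesis `hcor`; `N ≥ 4` — the hypothesis `hge4`.
[cite: CossartJannsenSaito2020, Def. 6.15, Thm. 6.28, Rem. 6.29] [cite: CossartPiltant2019, Thm. 1.1] -/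
theorem body_baseLevel_of_base_cores (hCJS : CossartJannsenSaito2020_sigmaMaxElimination.{0})
    (hCP : CossartPiltant2019General.{0})
    (hcor : ∀ p : ℕ, p.Prime → ∀ (k : Type) [Field k] [CharP k p] (X : Scheme.{0})
      (f : X ⟶ Spec (.of k)), IsSeparated f → LocallyOfFiniteType f → QuasiCompact f →
      IsReduced X → ¬ Scheme.IsRegular X → ((3 : ℕ) : WithBot ℕ∞) ≤ topologicalKrullDim X →
      topologicalKrullDim X ≤ ((3 : ℕ) : WithBot ℕ∞) →
      ¬ Disjoint (closure ((Scheme.regularLocus X)ᶜ \ Scheme.hsMaxLocus X 3))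
          (Scheme.hsMaxLocus X 3) →
        ∃ (X' : Scheme.{0}) (π : X' ⟶ X), IsProper π ∧ IsReduced X' ∧
          topologicalKrullDim X' ≤ ((3 : ℕ) : WithBot ℕ∞) ∧
          (∀ U : X.Opens, (U : Set X) ⊆ (Scheme.hsMaxLocus X 3)ᶜ → IsIso (π ∣_ U)) ∧
          Dense ((fun x' => π.base x') ⁻¹' (Scheme.hsMaxLocus X 3)ᶜ) ∧
          (∀ x' : X', Scheme.hsFun X' 3 x' ≤ Scheme.hsFun X 3 (π.base x')) ∧
          ∀ ν : ℕ → ℕ, Maximal (· ∈ Scheme.hsValues X 3) ν → ν ∉ Scheme.hsValues X' 3)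
    (hge4 : ∀ p : ℕ, p.Prime → ∀ (k : Type) [Field k] [CharP k p] (X : Scheme.{0})
      (f : X ⟶ Spec (.of k)), IsSeparated f → LocallyOfFiniteType f → QuasiCompact f →
      IsReduced X → ¬ Scheme.IsRegular X → ∀ N : ℕ, 4 ≤ N →
      (N : WithBot ℕ∞) ≤ topologicalKrullDim X → topologicalKrullDim X ≤ (N : WithBot ℕ∞) →
        ∃ (X' : Scheme.{0}) (π : X' ⟶ X), IsProper π ∧ IsReduced X' ∧
          topologicalKrullDim X' ≤ ((N : ℕ) : WithBot ℕ∞) ∧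
          (∀ U : X.Opens, (U : Set X) ⊆ (Scheme.hsMaxLocus X N)ᶜ → IsIso (π ∣_ U)) ∧
          Dense ((fun x' => π.base x') ⁻¹' (Scheme.hsMaxLocus X N)ᶜ) ∧
          (∀ x' : X', Scheme.hsFun X' N x' ≤ Scheme.hsFun X N (π.base x')) ∧
          ∀ ν : ℕ → ℕ, Maximal (· ∈ Scheme.hsValues X N) ν → ν ∉ Scheme.hsValues X' N)
    (p : ℕ) (hp : p.Prime) (k : Type) [Field k] [CharP k p] :
    ∀ (N : ℕ) (X : Scheme.{0}) (f : X ⟶ Spec (.of k)), IsSeparated f →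
      LocallyOfFiniteType f → QuasiCompact f → IsReduced X → ¬ Scheme.IsRegular X →
      (N : WithBot ℕ∞) ≤ topologicalKrullDim X → topologicalKrullDim X ≤ (N : WithBot ℕ∞) →
        ∃ (X' : Scheme.{0}) (π : X' ⟶ X), IsProper π ∧ IsReduced X' ∧
          topologicalKrullDim X' ≤ ((N : ℕ) : WithBot ℕ∞) ∧
          (∀ U : X.Opens, (U : Set X) ⊆ (Scheme.hsMaxLocus X N)ᶜ → IsIso (π ∣_ U)) ∧
          Dense ((fun x' => π.base x') ⁻¹' (Scheme.hsMaxLocus X N)ᶜ) ∧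
          (∀ x' : X', Scheme.hsFun X' N x' ≤ Scheme.hsFun X N (π.base x')) ∧
          ∀ ν : ℕ → ℕ, Maximal (· ∈ Scheme.hsValues X N) ν → ν ∉ Scheme.hsValues X' N := by
  intro N X f hsep hft hqc hred hreg hge hle
  rcases Nat.lt_or_ge N 2 with h1 | h2
  · -- curves: `dim X ≤ N ≤ 1`
    exact stub_curve stub_curveResolution k X f hsep hft hqc hred hreg
      (hle.trans (by exact_mod_cast (by omega : N ≤ 1))) N hle
  rcases h2.eq_or_lt with h2 | h3
  · -- surfaces at level `2`: the glued CJS fact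
    subst h2
    exact sigmaMaxModifications_dim_le_two hCJS k X f hft hqc hred hreg (by exact_mod_cast hle)
  rcases (show 3 ≤ N from h3).eq_or_lt with h3 | h4
  · -- threefolds at level `3`: isolated (Cossart–Piltant) or corridor
    subst h3
    by_cases hdisj : Disjoint (closure ((Scheme.regularLocus X)ᶜ \ Scheme.hsMaxLocus X 3))
        (Scheme.hsMaxLocus X 3)
    · have hcl : IsClosed (Scheme.hsMaxLocus X 3) :=
        (stub_isClosed_hsMaxLocus_over_field stub_hsFun_le_of_specializes_over_field k X f hft
          hqc 3 hle).2
      exact sigmaMaxModifications_dim_le_three_of_isolated hCP k X f hsep hft hqc hred hreg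
        (by exact_mod_cast hle) 3 hle hcl hdisj
    · exact hcor p hp k X f hsep hft hqc hred hreg hge hle hdisj
  · -- `dim X = N ≥ 4`
    exact hge4 p hp k X f hsep hft hqc hred hreg N h4 hge hle

/-- **The crux from its two open cores at the binding level, modulo the two printed theorems.**
[cite: CossartJannsenSaito2020, Def. 6.15, Cor. 6.18, Rem. 6.29] [cite: CossartPiltant2019, Thm. 1.1] -/
theorem sigmaMaxModifications_of_base_cores (hCJS : CossartJannsenSaito2020_sigmaMaxElimination.{0})
    (hCP : CossartPiltant2019General.{0})
    (hcor : ∀ p : ℕ, p.Prime → ∀ (k : Type) [Field k] [CharP k p] (X : Scheme.{0})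
      (f : X ⟶ Spec (.of k)), IsSeparated f → LocallyOfFiniteType f → QuasiCompact f →
      IsReduced X → ¬ Scheme.IsRegular X → ((3 : ℕ) : WithBot ℕ∞) ≤ topologicalKrullDim X →
      topologicalKrullDim X ≤ ((3 : ℕ) : WithBot ℕ∞) →
      ¬ Disjoint (closure ((Scheme.regularLocus X)ᶜ \ Scheme.hsMaxLocus X 3))
          (Scheme.hsMaxLocus X 3) →
        ∃ (X' : Scheme.{0}) (π : X' ⟶ X), IsProper π ∧ IsReduced X' ∧
          topologicalKrullDim X' ≤ ((3 : ℕ) : WithBot ℕ∞) ∧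
          (∀ U : X.Opens, (U : Set X) ⊆ (Scheme.hsMaxLocus X 3)ᶜ → IsIso (π ∣_ U)) ∧
          Dense ((fun x' => π.base x') ⁻¹' (Scheme.hsMaxLocus X 3)ᶜ) ∧
          (∀ x' : X', Scheme.hsFun X' 3 x' ≤ Scheme.hsFun X 3 (π.base x')) ∧
          ∀ ν : ℕ → ℕ, Maximal (· ∈ Scheme.hsValues X 3) ν → ν ∉ Scheme.hsValues X' 3)
    (hge4 : ∀ p : ℕ, p.Prime → ∀ (k : Type) [Field k] [CharP k p] (X : Scheme.{0})
      (f : X ⟶ Spec (.of k)), IsSeparated f → LocallyOfFiniteType f → QuasiCompact f →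
      IsReduced X → ¬ Scheme.IsRegular X → ∀ N : ℕ, 4 ≤ N →
      (N : WithBot ℕ∞) ≤ topologicalKrullDim X → topologicalKrullDim X ≤ (N : WithBot ℕ∞) →
        ∃ (X' : Scheme.{0}) (π : X' ⟶ X), IsProper π ∧ IsReduced X' ∧
          topologicalKrullDim X' ≤ ((N : ℕ) : WithBot ℕ∞) ∧
          (∀ U : X.Opens, (U : Set X) ⊆ (Scheme.hsMaxLocus X N)ᶜ → IsIso (π ∣_ U)) ∧
          Dense ((fun x' => π.base x') ⁻¹' (Scheme.hsMaxLocus X N)ᶜ) ∧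
          (∀ x' : X', Scheme.hsFun X' N x' ≤ Scheme.hsFun X N (π.base x')) ∧
          ∀ ν : ℕ → ℕ, Maximal (· ∈ Scheme.hsValues X N) ν → ν ∉ Scheme.hsValues X' N) :
    SigmaMaxModifications := by
  intro p hp k _ _ X f hsep hft hqc hred hreg N hdim
  exact body_allLevels_of_baseLevel k (body_baseLevel_of_base_cores hCJS hCP hcor hge4 p hp k) N X f
    hsep hft hqc hred hreg hdim

/-- **Equivalence: modulo `CossartJannsenSaito2020_sigmaMaxElimination` and
`CossartPiltant2019General`, the crux `SigmaMaxModifications` is exactly the conjunction of its two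
open cores AT THE BINDING LEVEL** — the corridor threefolds at `N = 3` and `dim X = N ≥ 4` (both are
instances of the crux, so the forward direction is trivial). This sharpens
`sigmaMaxModifications_iff_open_cores` (all levels) and is the honest content of item
stmt-ResolutionOfSingularities-18506 after line `Sketch`, reshape 5.
[cite: CossartJannsenSaito2020, Def. 6.15, Cor. 6.18, Rem. 6.29] [cite: CossartPiltant2019, §1] -/
theorem sigmaMaxModifications_iff_base_cores :
    CossartJannsenSaito2020_sigmaMaxElimination.{0} → CossartPiltant2019General.{0} →
    (SigmaMaxModifications ↔
      ((∀ p : ℕ, p.Prime → ∀ (k : Type) [Field k] [CharP k p] (X : Scheme.{0})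
      (f : X ⟶ Spec (.of k)), IsSeparated f → LocallyOfFiniteType f → QuasiCompact f →
      IsReduced X → ¬ Scheme.IsRegular X → ((3 : ℕ) : WithBot ℕ∞) ≤ topologicalKrullDim X →
      topologicalKrullDim X ≤ ((3 : ℕ) : WithBot ℕ∞) →
      ¬ Disjoint (closure ((Scheme.regularLocus X)ᶜ \ Scheme.hsMaxLocus X 3))
          (Scheme.hsMaxLocus X 3) →
        ∃ (X' : Scheme.{0}) (π : X' ⟶ X), IsProper π ∧ IsReduced X' ∧
          topologicalKrullDim X' ≤ ((3 : ℕ) : WithBot ℕ∞) ∧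
          (∀ U : X.Opens, (U : Set X) ⊆ (Scheme.hsMaxLocus X 3)ᶜ → IsIso (π ∣_ U)) ∧
          Dense ((fun x' => π.base x') ⁻¹' (Scheme.hsMaxLocus X 3)ᶜ) ∧
          (∀ x' : X', Scheme.hsFun X' 3 x' ≤ Scheme.hsFun X 3 (π.base x')) ∧
          ∀ ν : ℕ → ℕ, Maximal (· ∈ Scheme.hsValues X 3) ν → ν ∉ Scheme.hsValues X' 3) ∧
       (∀ p : ℕ, p.Prime → ∀ (k : Type) [Field k] [CharP k p] (X : Scheme.{0})
      (f : X ⟶ Spec (.of k)), IsSeparated f → LocallyOfFiniteType f → QuasiCompact f →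
      IsReduced X → ¬ Scheme.IsRegular X → ∀ N : ℕ, 4 ≤ N →
      (N : WithBot ℕ∞) ≤ topologicalKrullDim X → topologicalKrullDim X ≤ (N : WithBot ℕ∞) →
        ∃ (X' : Scheme.{0}) (π : X' ⟶ X), IsProper π ∧ IsReduced X' ∧
          topologicalKrullDim X' ≤ ((N : ℕ) : WithBot ℕ∞) ∧
          (∀ U : X.Opens, (U : Set X) ⊆ (Scheme.hsMaxLocus X N)ᶜ → IsIso (π ∣_ U)) ∧
          Dense ((fun x' => π.base x') ⁻¹' (Scheme.hsMaxLocus X N)ᶜ) ∧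
          (∀ x' : X', Scheme.hsFun X' N x' ≤ Scheme.hsFun X N (π.base x')) ∧
          ∀ ν : ℕ → ℕ, Maximal (· ∈ Scheme.hsValues X N) ν → ν ∉ Scheme.hsValues X' N))) := by
  intro hCJS hCP
  constructor
  · intro h
    exact ⟨fun p hp k _ _ X f hsep hft hqc hred hreg _ h3 _ =>
        h p hp k X f hsep hft hqc hred hreg 3 h3,
      fun p hp k _ _ X f hsep hft hqc hred hreg N _ _ hle =>
        h p hp k X f hsep hft hqc hred hreg N hle⟩
  · rintro ⟨hcor, hge4⟩
    exact sigmaMaxModifications_of_base_cores hCJS hCP hcor hge4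

/-! ## The fact-free split glue at the binding level (route vocabulary) -/

/-- **SPLIT GLUE AT THE BINDING LEVEL (fact-free):** the crux follows from `LowDim` (the body
when `dim X ≤ 2`, or `dim X ≤ 3` with `X_max` disjoint from `closure (Sing X ∖ X_max)`, at every
level — verbatim the strategist's child `SigmaMaxModificationsLowDim`), `Corridor3@3` (the body at
level `3` for `dim X = 3` in the corridor case) and `DimGe4@base` (the body at level `N = dim X`
for `dim X ≥ 4`), all three written in the route file's inline vocabulary (`H`, `X_max`, `Sing X`
inlined; `= Scheme.hsFun / hsMaxLocus / (regularLocus)ᶜ` by `rfl`). Proof: the level induction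
`body_allLevels_of_baseLevel` over the landed `stub_levelRaise`; no named fact is used.
[cite: CossartJannsenSaito2020, Def. 6.15, Rem. 2.29 (b), Rem. 6.29] -/
theorem SigmaMaxModifications_of_subs_base :
    (∀ p : ℕ, p.Prime → ∀ (k : Type) [Field k] [CharP k p] (X : AlgebraicGeometry.Scheme.{0}) (f : X ⟶ AlgebraicGeometry.Spec (.of k)), AlgebraicGeometry.IsSeparated f → AlgebraicGeometry.LocallyOfFiniteType f → AlgebraicGeometry.QuasiCompact f → AlgebraicGeometry.IsReduced X → ¬ Literature.AlgebraicGeometry.Resolution.Scheme.IsRegular X → ∀ N : ℕ, topologicalKrullDim X ≤ (N : WithBot ℕ∞) → let H : (Y : AlgebraicGeometry.Scheme.{0}) → Y → ℕ → ℕ := fun Y y => Literature.RingTheory.HilbertSamuel.hilbertSamuelFun (Y.presheaf.stalk y) (N - Literature.RingTheory.HilbertSamuel.minimalPrimesCodim (Y.presheaf.stalk y)); (topologicalKrullDim X ≤ ((2 : ℕ) : WithBot ℕ∞) ∨ (topologicalKrullDim X ≤ ((3 : ℕ) : WithBot ℕ∞) ∧ Disjoint (closure ({x : X | IsRegularLocalRing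 (X.presheaf.stalk x)}ᶜ \ {x | Maximal (· ∈ Set.range (H X)) (H X x)})) {x | Maximal (· ∈ Set.range (H X)) (H X x)})) → ∃ (X' : AlgebraicGeometry.Scheme.{0}) (π : X' ⟶ X), AlgebraicGeometry.IsProper π ∧ AlgebraicGeometry.IsReduced X' ∧ topologicalKrullDim X' ≤ (N : WithBot ℕ∞) ∧ (∀ U : X.Opens, (U : Set X) ⊆ {x | Maximal (· ∈ Set.range (H X)) (H X x)}ᶜ → CategoryTheory.IsIso (π ∣_ U)) ∧ Dense ((fun x' => π.base x') ⁻¹' {x | Maximal (· ∈ Set.range (H X)) (H X x)}ᶜ) ∧ (∀ x' : X', H X' x' ≤ H X (π.base x')) ∧ ∀ ν : ℕ → ℕ, Maximal (· ∈ Set.range (H X)) ν → ν ∉ Set.range (H X')) →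
    (∀ p : ℕ, p.Prime → ∀ (k : Type) [Field k] [CharP k p] (X : AlgebraicGeometry.Scheme.{0}) (f : X ⟶ AlgebraicGeometry.Spec (.of k)), AlgebraicGeometry.IsSeparated f → AlgebraicGeometry.LocallyOfFiniteType f → AlgebraicGeometry.QuasiCompact f → AlgebraicGeometry.IsReduced X → ¬ Literature.AlgebraicGeometry.Resolution.Scheme.IsRegular X → ((3 : ℕ) : WithBot ℕ∞) ≤ topologicalKrullDim X → topologicalKrullDim X ≤ ((3 : ℕ) : WithBot ℕ∞) → let H : (Y : AlgebraicGeometry.Scheme.{0}) → Y → ℕ → ℕ := fun Y y => Literature.RingTheory.HilbertSamuel.hilbertSamuelFun (Y.presheaf.stalk y) (3 - Literature.RingTheory.HilbertSamuel.minimalPrimesCodim (Y.presheaf.stalk y)); ¬ Disjoint (closure ({x : X | IsRegularLocalRing (X.presheaf.stalk x)}ᶜ \ {x | Maximal (· ∈ Set.range (H X)) (H X x)})) {x | Maximal (· ∈ Set.range (H X)) (H X x)} → ∃ (X' : AlgebraicGeometry.Scheme.{0}) (π : X' ⟶ X), AlgebraicGeometry.IsProper π ∧ AlgebraicGeometry.IsReduced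 X' ∧ topologicalKrullDim X' ≤ ((3 : ℕ) : WithBot ℕ∞) ∧ (∀ U : X.Opens, (U : Set X) ⊆ {x | Maximal (· ∈ Set.range (H X)) (H X x)}ᶜ → CategoryTheory.IsIso (π ∣_ U)) ∧ Dense ((fun x' => π.base x') ⁻¹' {x | Maximal (· ∈ Set.range (H X)) (H X x)}ᶜ) ∧ (∀ x' : X', H X' x' ≤ H X (π.base x')) ∧ ∀ ν : ℕ → ℕ, Maximal (· ∈ Set.range (H X)) ν → ν ∉ Set.range (H X')) →
    (∀ p : ℕ, p.Prime → ∀ (k : Type) [Field k] [CharP k p] (X : AlgebraicGeometry.Scheme.{0}) (f : X ⟶ AlgebraicGeometry.Spec (.of k)), AlgebraicGeometry.IsSeparated f → AlgebraicGeometry.LocallyOfFiniteType f → AlgebraicGeometry.QuasiCompact f → AlgebraicGeometry.IsReduced X → ¬ Literature.AlgebraicGeometry.Resolution.Scheme.IsRegular X → ∀ N : ℕ, 4 ≤ N → (N : WithBot ℕ∞) ≤ topologicalKrullDim X → topologicalKrullDim X ≤ (N : WithBot ℕ∞) → let H : (Y : AlgebraicGeometry.Scheme.{0}) → Y → ℕ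 → ℕ := fun Y y => Literature.RingTheory.HilbertSamuel.hilbertSamuelFun (Y.presheaf.stalk y) (N - Literature.RingTheory.HilbertSamuel.minimalPrimesCodim (Y.presheaf.stalk y)); ∃ (X' : AlgebraicGeometry.Scheme.{0}) (π : X' ⟶ X), AlgebraicGeometry.IsProper π ∧ AlgebraicGeometry.IsReduced X' ∧ topologicalKrullDim X' ≤ (N : WithBot ℕ∞) ∧ (∀ U : X.Opens, (U : Set X) ⊆ {x | Maximal (· ∈ Set.range (H X)) (H X x)}ᶜ → CategoryTheory.IsIso (π ∣_ U)) ∧ Dense ((fun x' => π.base x') ⁻¹' {x | Maximal (· ∈ Set.range (H X)) (H X x)}ᶜ) ∧ (∀ x' : X', H X' x' ≤ H X (π.base x')) ∧ ∀ ν : ℕ → ℕ, Maximal (· ∈ Set.range (H X)) ν → ν ∉ Set.range (H X')) →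
    SigmaMaxModifications := by
  intro hlow hcor hge4 p hp k _ _ X₀ f₀ hsep₀ hft₀ hqc₀ hred₀ hreg₀ N₀ hdim₀
  refine body_allLevels_of_baseLevel k ?_ N₀ X₀ f₀ hsep₀ hft₀ hqc₀ hred₀ hreg₀ hdim₀
  intro N X f hsep hft hqc hred hreg hge hle
  rcases Nat.lt_or_ge N 3 with h2 | h3
  · -- `dim X = N ≤ 2`
    exact hlow p hp k X f hsep hft hqc hred hreg N hle
      (Or.inl (hle.trans (by exact_mod_cast (by omega : N ≤ 2))))
  rcases h3.eq_or_lt with h3 | h4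
  · -- `dim X = N = 3`: isolated or corridor
    subst h3
    by_cases hdisj : Disjoint (closure ((Scheme.regularLocus X)ᶜ \ Scheme.hsMaxLocus X 3))
        (Scheme.hsMaxLocus X 3)
    · exact hlow p hp k X f hsep hft hqc hred hreg 3 hle (Or.inr ⟨hle, hdisj⟩)
    · exact hcor p hp k X f hsep hft hqc hred hreg hge hle hdisj
  · -- `dim X = N ≥ 4`
    exact hge4 p hp k X f hsep hft hqc hred hreg N h4 hge hle

end Summit.ResolutionOfSingularities.ResolutionOfSingularities.Theorems.SigmaMaxModifications.Sketch

end
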